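import Mathlib
import HarnessLib
import Literature.MathematicalPhysics.QuantumLattice.PairFieldMomentum
import Summits.HubbardSuperconductivity.HubbardSuperconductivity.Theorems.WeakCouplingBCSWcbcsBcsConstructionDoubleCommutatorBound
import Summits.HubbardSuperconductivity.HubbardSuperconductivity.Theorems.WeakCouplingBCSWcbcsBcsConstructionTrialStateBound
import Summits.HubbardSuperconductivity.HubbardSuperconductivity.Theorems.WeakCouplingBCSWcbcsTowerTrialBudgetAbstract
import Summits.HubbardSuperconductivity.HubbardSuperconductivity.Theorems.WeakCouplingBCSWcbcsTowerTrialBudgetSlater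

/-!
# Route `WeakCouplingBCS`, support item `WcbcsTowerTrialBudget` (stmt-HubbardSuperconductivity-1211):
# proof

Closes the support item `WcbcsTowerTrialBudget` (rank 8) of route
`HubbardSuperconductivity/WeakCouplingBCS` — the TOWER TRIAL-STATE BUDGET of idea card
`probe-legendre-order-ceiling` (Koma–Tasaki, J. Stat. Phys. 76 (1994) 745, Theorem 2.2 'lite', all at
finite `L`): for every form factor `g` there is `B(g)` with, for every `L ≥ 1`, `U ≥ 0`, `μ`, `h`, `N`,
every normalised `(N, S^z=0)`-sector ground state `Φ` of `H_U = hubbardTorus 2 L 1 U` with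
`q = ‖OΦ‖² > 0` (`O = Δ_g + Δ_g†`) and every lower bound `E` of `K_μ - hO` on unit vectors
(`K_μ = hubbardTorusWith 2 L 1 0 μ`),
`h√q ≤ E₀^{sec,free}(N) + U N²/(4L²) - μN + |μ| + B(1+U)L²/q - E`.

Assembly of: the abstract budget `WcbcsTowerTrial.trial_budget` (…`Abstract.lean`); the selection
rule `[N, Δ_g] = -2Δ_g` (`PairFieldMomentum`); `H(1,0) ≤ H(1,U)` for `U ≥ 0`
(`re_free_le_re_interacting`); the graded-locality bound `‖[O,[O,H_U]]‖ ≤ B(2+U)L²`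
(`dc_norm_doubleCommutator_pairField_le` of `…DoubleCommutatorBound.lean`, at `t = 1`, `μ = 0`);
and the Slater-type bound `E_U^{sec}(N) ≤ E₀^{sec,free}(N) + U N²/(4L²)` (…`Slater.lean`).
`B(g) = 144 s²(s+2) K_g²`, `s = #{0, ±e₁, ±e₂}`, `K_g = 2Σ_e |g e/√2|`. The hypothesis `0 ≤ h` of the
item is not needed (the source term enters with an exact coefficient).

The closing theorem `wcbcsTowerTrialBudget_proof` has as TYPE the body of the route declaration
`Summit.HubbardSuperconductivity.HubbardSuperconductivity.Theses.WeakCouplingBCS.WcbcsTowerTrialBudget`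
spelled out verbatim; per the route header the Theses module is NOT imported (the gate links
`WcbcsTowerTrialBudget_holds` by importing this module into the route file). No definitions.
-/

-- the summit-side namespace `Summit.HubbardSuperconductivity.HubbardSuperconductivity` repeats a
-- component by design (D-0017 nested layout), which the `dupNamespace` linter would flag:
set_option linter.dupNamespace false

namespace Summit.HubbardSuperconductivity.HubbardSuperconductivity.Theorems

open Literature.MathematicalPhysics.QuantumLattice Literature.Probability.LatticeModels Matrix
open scoped Matrix.Norms.L2Operator ComplexOrder

namespace WcbcsTowerTrial

/-- The on-site repulsion is a nonnegative quadratic form: `Re ⟨v, (Σ_x n_{x↑} n_{x↓}) v⟩ ≥ 0`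
(each `n_{x↑} n_{x↓}` is the diagonal double-occupancy indicator). [folklore] -/
theorem re_interaction_nonneg {Λ : Type*} [LinearOrder Λ] [Fintype Λ] (v : Fock (Orb Λ)) :
    0 ≤ (star v ⬝ᵥ ((∑ x : Λ, numberOp x 0 * numberOp x 1) *ᵥ v)).re := by
  rw [Matrix.sum_mulVec, dotProduct_sum, Complex.re_sum]
  refine Finset.sum_nonneg fun x _ => ?_
  rw [LiebThm1.numberOp_eq_diagonal, LiebThm1.numberOp_eq_diagonal, diagonal_mul_diagonal,
    dotProduct, Complex.re_sum]
  refine Finset.sum_nonneg fun s _ => ?_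
  rw [mulVec_diagonal, Pi.star_apply]
  by_cases h0 : orb x 0 ∈ s <;> by_cases h1 : orb x 1 ∈ s <;>
    simp [h0, h1, Complex.mul_re, Complex.conj_re, Complex.conj_im, ← sq, sq_nonneg, add_nonneg]

/-- `H(1, U) = H(1, 0) + U Σ_x n_{x↑} n_{x↓}` on the torus. [folklore] -/
theorem hubbardTorus_eq_free_add (L : ℕ) (U : ℝ) :
    hubbardTorus 2 L 1 U = hubbardTorus 2 L 1 0 +
      (U : ℂ) • ∑ x : FermionTorus 2 L, numberOp x 0 * numberOp x 1 := by
  rw [hubbardTorus, hubbardTorus, hamiltonian, hamiltonian, Complex.ofReal_zero, zero_smul, add_zero]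

/-- For `U ≥ 0` the free Hamiltonian is dominated by the interacting one as a quadratic form:
`Re ⟨v, H(1,0) v⟩ ≤ Re ⟨v, H(1,U) v⟩`. [folklore] -/
theorem re_free_le_re_interacting (L : ℕ) {U : ℝ} (hU : 0 ≤ U) (v : Fock (Orb (FermionTorus 2 L))) :
    (star v ⬝ᵥ (hubbardTorus 2 L 1 0 *ᵥ v)).re ≤ (star v ⬝ᵥ (hubbardTorus 2 L 1 U *ᵥ v)).re := by
  rw [hubbardTorus_eq_free_add L U, add_mulVec, smul_mulVec, dotProduct_add, dotProduct_smul, smul_eq_mul,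
    Complex.add_re, Complex.re_ofReal_mul]
  have := re_interaction_nonneg v
  nlinarith

/-- `[N, Δ_g] = -2 Δ_g` for the pair field of any form factor `g`. [folklore] -/
theorem totalNumber_commutator_pairField (g : Site 2 → ℝ) (L : ℕ) [NeZero L] :
    totalNumber * pairField g L - pairField g L * totalNumber = ((-2 : ℝ) : ℂ) • pairField g L := by
  have h := totalNumber_commutator_pairFieldAt g L 0
  rw [pairFieldAt_zero] at h
  rw [h, Complex.ofReal_neg, Complex.ofReal_ofNat]

/-- The double-commutator bound at `t = 1`, `μ = 0` in the shape `‖[O,[O,H(1,U)]]‖ ≤ A_g (2 + U) L²`,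
`A_g = 144 s²(s+2) K_g²`, `s = #{0, ±e₁, ±e₂}`, `K_g = 2 Σ_e |g e/√2|`
(`dc_norm_doubleCommutator_pairField_le`). [cite: KomaTasaki1994, Theorem 2.2] -/
theorem norm_doubleCommutator_hubbardTorus_le (g : Site 2 → ℝ) (L : ℕ) [NeZero L] {U : ℝ} (hU : 0 ≤ U) :
    ‖(pairField g L + (pairField g L)ᴴ) *
          ((pairField g L + (pairField g L)ᴴ) * hubbardTorus 2 L 1 U -
            hubbardTorus 2 L 1 U * (pairField g L + (pairField g L)ᴴ)) -
        ((pairField g L + (pairField g L)ᴴ) * hubbardTorus 2 L 1 U -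
            hubbardTorus 2 L 1 U * (pairField g L + (pairField g L)ᴴ)) *
          (pairField g L + (pairField g L)ᴴ)‖ ≤
      144 * ((insert (0 : Site 2) unitSteps).card : ℝ) ^ 2 * ((insert (0 : Site 2) unitSteps).card + 2) *
        (2 * ∑ e ∈ insert (0 : Site 2) unitSteps, |g e / Real.sqrt 2|) ^ 2 * (2 + U) * (L : ℝ) ^ 2 := by
  have key := dc_norm_doubleCommutator_pairField_le g L 1 U 0
  rw [hubbardTorusWith_zero, abs_one, abs_zero, abs_of_nonneg hU, mul_zero, add_zero, mul_one] at key
  exact key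

end WcbcsTowerTrial

open WcbcsTowerTrial WcbcsTrialState in
/-- **`WcbcsTowerTrialBudget` (item stmt-HubbardSuperconductivity-1211 of route WeakCouplingBCS),
proved.** TOWER TRIAL-STATE BUDGET (Koma–Tasaki Theorem 2.2 'lite' at finite `L`): for every form
factor `g` there is `B = B(g)` (here `B = 144 s²(s+2) K_g²`, `s = #{0, ±e₁, ±e₂}`, `K_g = 2 Σ_e |g e/√2|`)
such that for every `L ≥ 1`, `U ≥ 0`, `μ`, `h`, `N`, every normalised `(N, S^z = 0)`-sector ground state
`Φ` of `H_U = hubbardTorus 2 L 1 U` with `q = ‖OΦ‖² > 0`, `O = Δ_g + Δ_g†`, and every lower bound `E`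
of `K_μ - hO` on unit vectors (`K_μ = hubbardTorusWith 2 L 1 0 μ`):
`h √q ≤ E₀^{sec,free}(N) + U N²/(4L²) - μN + |μ| + B(1+U)L²/q - E`.
Proof: the abstract trial-state budget `WcbcsTowerTrial.trial_budget` for `Ξ = Φ + OΦ/√q`
(selection rules from `[N, Δ_g] = -2Δ_g`; `H(1,0) ≤ H(1,U)` since `U Σ n↑n↓ ≥ 0`; the
double-commutator identity for the eigenvector `Φ`), the graded-locality bound
`‖[O,[O,H_U]]‖ ≤ B (2+U) L²` (`dc_norm_doubleCommutator_pairField_le`), and the Slater-type bound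
`E_U^{sec}(N) ≤ E₀^{sec,free}(N) + U N²/(4L²)` proved by averaging over up-spin translations
(`WcbcsSlater.minEnergyOn_szSector_hubbardTorus_two_le`). The type is the route declaration
`Summit.HubbardSuperconductivity.HubbardSuperconductivity.Theses.WeakCouplingBCS.WcbcsTowerTrialBudget`
spelled out (the route file is not imported, so that the gate can link `_holds` without a cycle).
[cite: KomaTasaki1994, Theorem 2.2] -/
theorem wcbcsTowerTrialBudget_proof :
      ∀ (g : Literature.Probability.LatticeModels.Site 2 → ℝ), ∃ B : ℝ, ∀ (L : ℕ) [NeZero L] (U μ h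
      : ℝ), 0 ≤ U → 0 ≤ h → ∀ (N : ℕ) (Φ : Literature.MathematicalPhysics.QuantumLattice.Fock
      (Literature.MathematicalPhysics.QuantumLattice.Orb
      (Literature.MathematicalPhysics.QuantumLattice.FermionTorus 2 L))),
      Literature.MathematicalPhysics.QuantumLattice.IsGroundStateInSector
      (Literature.MathematicalPhysics.QuantumLattice.hubbardTorus 2 L 1 U) N 0 Φ → star Φ ⬝ᵥ Φ = 1 →
      ∀ E : ℝ, (∀ φ : Literature.MathematicalPhysics.QuantumLattice.Fock
      (Literature.MathematicalPhysics.QuantumLattice.Orb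
      (Literature.MathematicalPhysics.QuantumLattice.FermionTorus 2 L)), star φ ⬝ᵥ φ = 1 → E ≤ (star
      φ ⬝ᵥ Matrix.mulVec (Literature.MathematicalPhysics.QuantumLattice.hubbardTorusWith 2 L 1 0 μ -
      (h : ℂ) • (Literature.MathematicalPhysics.QuantumLattice.pairField g L + Matrix.conjTranspose
      (Literature.MathematicalPhysics.QuantumLattice.pairField g L))) φ).re) → 0 < (star
      (Matrix.mulVec (Literature.MathematicalPhysics.QuantumLattice.pairField g L +
      Matrix.conjTranspose (Literature.MathematicalPhysics.QuantumLattice.pairField g L)) Φ) ⬝ᵥ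
      Matrix.mulVec (Literature.MathematicalPhysics.QuantumLattice.pairField g L +
      Matrix.conjTranspose (Literature.MathematicalPhysics.QuantumLattice.pairField g L)) Φ).re → h
      * Real.sqrt ((star (Matrix.mulVec (Literature.MathematicalPhysics.QuantumLattice.pairField g L
      + Matrix.conjTranspose (Literature.MathematicalPhysics.QuantumLattice.pairField g L)) Φ) ⬝ᵥ
      Matrix.mulVec (Literature.MathematicalPhysics.QuantumLattice.pairField g L +
      Matrix.conjTranspose (Literature.MathematicalPhysics.QuantumLattice.pairField g L)) Φ).re) ≤
      (Literature.MathematicalPhysics.QuantumLattice.hubbardTorus 2 L 1 0).minEnergyOn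
      (Literature.MathematicalPhysics.QuantumLattice.szSector N 0) + U * (N : ℝ) ^ 2 / (4 * (L : ℝ)
      ^ 2) - μ * (N : ℝ) + |μ| + B * (1 + U) * (L : ℝ) ^ 2 / (star (Matrix.mulVec
      (Literature.MathematicalPhysics.QuantumLattice.pairField g L + Matrix.conjTranspose
      (Literature.MathematicalPhysics.QuantumLattice.pairField g L)) Φ) ⬝ᵥ Matrix.mulVec
      (Literature.MathematicalPhysics.QuantumLattice.pairField g L + Matrix.conjTranspose
      (Literature.MathematicalPhysics.QuantumLattice.pairField g L)) Φ).re - E := by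
  intro g
  set S : Finset (Site 2) := insert 0 unitSteps with hS_def
  set A : ℝ := 144 * (S.card : ℝ) ^ 2 * (S.card + 2) *
    (2 * ∑ e ∈ S, |g e / Real.sqrt 2|) ^ 2 with hA_def
  have hA0 : 0 ≤ A := by positivity
  refine ⟨A, ?_⟩
  intro L _ U μ h hU _ N Φ hGS hΦ1 E hE hq
  obtain ⟨hmem, hne, heig⟩ := hGS
  set X := pairField g L with hX_def
  set H := hubbardTorus 2 L 1 U with hH_def
  -- hypotheses of the abstract budget
  have hH : H.IsHermitian := LiebThm1.hamiltonian_isHermitian (fermionTorusGraph 2 L) 1 U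
  have hNh : (totalNumber : Matrix (Finset (Orb (FermionTorus 2 L))) _ ℂ).IsHermitian :=
    totalNumber_isHermitian
  have hX : totalNumber * X - X * totalNumber = ((-2 : ℝ) : ℂ) • X := totalNumber_commutator_pairField g L
  have hNΦ := WcbcsTrialState.totalNumber_mulVec_of_isNParticle ((mem_szSector_iff _ _ _).1 hmem).1
  have hE' : ∀ φ : Fock (Orb (FermionTorus 2 L)), star φ ⬝ᵥ φ = 1 →
      E ≤ (star φ ⬝ᵥ ((hubbardTorus 2 L 1 0 - (μ : ℂ) • totalNumber - (h : ℂ) • (X + Xᴴ)) *ᵥ φ)).re :=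
    fun φ hφ => by rw [← hubbardTorusWith_eq]; exact hE φ hφ
  have key := trial_budget hH hNh hX (re_free_le_re_interacting L hU) hΦ1 heig hNΦ hE' hq
  -- the sector energy (Slater-type bound) and the double commutator
  have hslater := WcbcsSlater.minEnergyOn_szSector_hubbardTorus_two_le L 1 hU hmem hne
  have hD := norm_doubleCommutator_hubbardTorus_le g L hU
  set q : ℝ := (star ((X + Xᴴ) *ᵥ Φ) ⬝ᵥ ((X + Xᴴ) *ᵥ Φ)).re with hq_def
  have hq_pos : 0 < q := hq
  have hL2 : (0 : ℝ) ≤ (L : ℝ) ^ 2 := by positivity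
  have hDle : ‖(X + Xᴴ) * ((X + Xᴴ) * H - H * (X + Xᴴ)) - ((X + Xᴴ) * H - H * (X + Xᴴ)) * (X + Xᴴ)‖ /
      (4 * q) ≤ A * (1 + U) * (L : ℝ) ^ 2 / q := by
    rw [div_le_div_iff₀ (by positivity) hq_pos]
    have h1 : A * (2 + U) * (L : ℝ) ^ 2 ≤ A * (1 + U) * (L : ℝ) ^ 2 * 4 := by
      nlinarith [mul_nonneg (mul_nonneg hA0 hL2) hU, mul_nonneg hA0 hL2]
    have h2 := mul_le_mul_of_nonneg_right (hD.trans h1) hq_pos.le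
    nlinarith [h2]
  linarith [key, hslater, hDle]

end Summit.HubbardSuperconductivity.HubbardSuperconductivity.Theorems
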